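import Summits.CriticalPhenomena.CardyFormulaZ2.Theses.CardyFlipRusso
import Literature.Probability.Percolation.VoronoiCrossing
import Literature.Probability.Percolation.TriVoronoiCells

/-!
# `JitteredTriangularLeg` at `σ = 0`: the dictionary with site percolation on `𝕋`

Helper file for the support item `JitteredTriangularLeg` (stmt-CriticalPhenomena-6436) of route
`CardyFlipRusso` (sub-problem `CardyFormulaZ2`).  The item asserts Cardy's formula for the annealed
Voronoi percolation of the Gaussian-jittered triangular lattice `𝕋 + σ (ξ¹ + i ξ²)` for every
`σ ≥ 0`; for `σ > 0` this is an instance of crossing universality and is open.  This file records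
the provable dictionary at the base point `σ = 0` of the leg, where the nuclei are the sites of
`𝕋`, the Voronoi cells are the closed hexagons of the honeycomb lattice and the annealed law
factors through fair site percolation on `𝕋` (Bollobás–Riordan, *Percolation* (2006), Ch. 5 §5.1
"site percolation on the triangular lattice … as a colouring of the hexagonal faces", Ch. 7 proof
of Thm. 2 p. 199, Ch. 8 §8.1):

* `jitteredTriangularLeg_iff` — the route declaration is, definitionally, the statement with the
  Literature event `voronoiCrossing`;
* `real_prod_setOf_snd`, `jitterNuclei_zero`, `jitteredLeg_real_zero`,
  `hasCrossingLimit_jitteredLeg_zero_iff` — at `σ = 0` the annealed crossing probability is the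
  `P_{1/2}`-probability, for site percolation on `𝕋`, of the continuum crossing of `closure Ω`
  by the closed hexagons of the open sites;
* `le_dist_triMeshPoint_of_ne`, `isClosed_image_triMeshPoint` — distinct sites of `δ𝕋` are `≥ δ`
  apart; any set of sites of `δ𝕋` is closed;
* `blackRegion_image_triMeshPoint`, `voronoiCrossing_triEmbed_iff` — the black region of the
  `𝕋`-colouring is the union of the closed Voronoi cells (hexagons) of the black sites, so the
  crossing event is a continuum path in `closure Ω` through black hexagons;
* `segment_subset_voronoiCell_union`, `segment_subset_blackRegion` — the segment joining two
  adjacent black sites is black (the polygonal drawing of an open `𝕋`-path is a black path);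
* `exists_pathIn_of_voronoiCrossing` — the lattice shadow of a continuum crossing: an open
  `𝕋`-path, through sites whose hexagons meet `closure Ω`, from a site whose hexagon meets the
  first arc to one whose hexagon meets the second (`exists_pathIn_of_subset_triVoronoiCell`).

## References

* B. Bollobás, O. Riordan, *Percolation*, Cambridge University Press (2006), Ch. 5 §5.1, Ch. 7
  p. 199, Ch. 8 §8.1–8.2.
* S. Smirnov, *Critical percolation in the plane*, C. R. Acad. Sci. Paris 333 (2001), §2.
-/

noncomputable section

open MeasureTheory Set Metric
open scoped Pointwise

namespace Summit.CriticalPhenomena.CardyFormulaZ2.Theorems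

open Literature.Probability.Percolation Literature.Probability.LatticeModels
  Literature.Probability.RandomPlanarGeometry
-- buildfix lane 2026-08-20: namespace-local alias(es) so that short names made ambiguous by the
-- 2026-08-15 Literature migration (old home vs re-exported new home, both in the import cone) resolve,
-- as in the accepted build, to `Literature.Probability.RandomPlanarGeometry` (the constant route `CardyFlipRusso` uses). No declaration text changes.
export Literature.Probability.RandomPlanarGeometry (cardyFunction)

/-! ### The route declaration in terms of `voronoiCrossing` -/

/-- The route declaration `JitteredTriangularLeg` unfolds, definitionally, to Cardy's formula for
the continuum Voronoi crossing event `voronoiCrossing` of the Literature (the inline event of the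
route item is `voronoiCrossing_iff`, `Iff.rfl`). [folklore] -/
theorem jitteredTriangularLeg_iff :
    Summit.CriticalPhenomena.CardyFormulaZ2.Theses.CardyFlipRusso.JitteredTriangularLeg ↔
    (hasCrossingLimit_triDomainCrossingProb → ∀ σ : ℝ, 0 ≤ σ → ∀ R : ConformalRectangle,
      R.HasCrossingLimit (fun δ ↦ ((Measure.infinitePi (fun _ : Site 2 ↦
        (ProbabilityTheory.gaussianReal 0 1).prod (ProbabilityTheory.gaussianReal 0 1))).prod
          (sitePercolation (Site 2) half)).real
        {p | voronoiCrossing R.carrier (R.arc 0) (R.arc 2) δ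
          ((fun v ↦ triEmbed v + (σ : ℂ) * ((p.1 v).1 + (p.1 v).2 * Complex.I)) '' p.2)
          ((fun v ↦ triEmbed v + (σ : ℂ) * ((p.1 v).1 + (p.1 v).2 * Complex.I)) '' (p.2)ᶜ)})
        cardyFunction) :=
  Iff.rfl

/-! ### `σ = 0`: the annealed law factors through site percolation on `𝕋` -/

/-- An event of a product probability space that only reads the second coordinate has the
probability of its second-coordinate slice (`Measure.prod_prod` needs no measurability). [folklore] -/
theorem real_prod_setOf_snd {α β : Type*} [MeasurableSpace α] [MeasurableSpace β]
    (μ : Measure α) [IsProbabilityMeasure μ] (ν : Measure β) [SFinite ν] (P : β → Prop) :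
    (μ.prod ν).real {p : α × β | P p.2} = ν.real {b | P b} := by
  have hset : {p : α × β | P p.2} = (univ : Set α) ×ˢ {b | P b} := by
    ext p; simp
  rw [measureReal_def, measureReal_def, hset, Measure.prod_prod, measure_univ, one_mul]

/-- At `σ = 0` the jittered nuclei are the sites of `𝕋`, whatever the displacements `ξ`. [folklore] -/
theorem jitterNuclei_zero (ξ : Site 2 → ℝ × ℝ) :
    (fun v ↦ triEmbed v + ((0 : ℝ) : ℂ) * ((ξ v).1 + (ξ v).2 * Complex.I)) = triEmbed := by
  funext v
  simp

/-- **The base point of the leg.** At `σ = 0` the annealed crossing probability of the jittered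
triangular lattice is the `P_{1/2}`-probability, for site percolation on `𝕋`, of the continuum
Voronoi crossing with black nuclei the open sites and white nuclei the closed sites (the fair
colouring of the hexagonal faces, Bollobás–Riordan 2006, Ch. 5 §5.1). [cite: BollobasRiordan2006, Ch. 5 §5.1] -/
theorem jitteredLeg_real_zero (R : ConformalRectangle) (δ : ℝ) :
    ((Measure.infinitePi (fun _ : Site 2 ↦
        (ProbabilityTheory.gaussianReal 0 1).prod (ProbabilityTheory.gaussianReal 0 1))).prod
          (sitePercolation (Site 2) half)).real
        {p | voronoiCrossing R.carrier (R.arc 0) (R.arc 2) δ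
          ((fun v ↦ triEmbed v + ((0 : ℝ) : ℂ) * ((p.1 v).1 + (p.1 v).2 * Complex.I)) '' p.2)
          ((fun v ↦ triEmbed v + ((0 : ℝ) : ℂ) * ((p.1 v).1 + (p.1 v).2 * Complex.I)) '' (p.2)ᶜ)}
      = (sitePercolation (Site 2) half).real
          {ω | voronoiCrossing R.carrier (R.arc 0) (R.arc 2) δ (triEmbed '' ω) (triEmbed '' ωᶜ)} := by
  simp only [jitterNuclei_zero]
  exact real_prod_setOf_snd _ _
    (fun ω : SiteConfig (Site 2) ↦ voronoiCrossing R.carrier (R.arc 0) (R.arc 2) δ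
      (triEmbed '' ω) (triEmbed '' ωᶜ))

/-- **`JitteredTriangularLeg` at `σ = 0`, restated on `𝕋`**: the `σ = 0` instance of the
conclusion of the route item is Cardy's formula for the continuum crossing of `closure Ω` by the
closed hexagons of the open sites of fair site percolation on `𝕋` (Smirnov's model with the
continuum-path event in place of G02's `triCrossing`). [cite: BollobasRiordan2006, Ch. 7 p. 199] -/
theorem hasCrossingLimit_jitteredLeg_zero_iff (R : ConformalRectangle) :
    R.HasCrossingLimit (fun δ ↦ ((Measure.infinitePi (fun _ : Site 2 ↦
        (ProbabilityTheory.gaussianReal 0 1).prod (ProbabilityTheory.gaussianReal 0 1))).prod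
          (sitePercolation (Site 2) half)).real
        {p | voronoiCrossing R.carrier (R.arc 0) (R.arc 2) δ
          ((fun v ↦ triEmbed v + ((0 : ℝ) : ℂ) * ((p.1 v).1 + (p.1 v).2 * Complex.I)) '' p.2)
          ((fun v ↦ triEmbed v + ((0 : ℝ) : ℂ) * ((p.1 v).1 + (p.1 v).2 * Complex.I)) '' (p.2)ᶜ)})
        cardyFunction ↔
    R.HasCrossingLimit (fun δ ↦ (sitePercolation (Site 2) half).real
        {ω | voronoiCrossing R.carrier (R.arc 0) (R.arc 2) δ (triEmbed '' ω) (triEmbed '' ωᶜ)})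
        cardyFunction := by
  rw [show (fun δ ↦ ((Measure.infinitePi (fun _ : Site 2 ↦
        (ProbabilityTheory.gaussianReal 0 1).prod (ProbabilityTheory.gaussianReal 0 1))).prod
          (sitePercolation (Site 2) half)).real
        {p | voronoiCrossing R.carrier (R.arc 0) (R.arc 2) δ
          ((fun v ↦ triEmbed v + ((0 : ℝ) : ℂ) * ((p.1 v).1 + (p.1 v).2 * Complex.I)) '' p.2)
          ((fun v ↦ triEmbed v + ((0 : ℝ) : ℂ) * ((p.1 v).1 + (p.1 v).2 * Complex.I)) '' (p.2)ᶜ)})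
      = (fun δ ↦ (sitePercolation (Site 2) half).real
        {ω | voronoiCrossing R.carrier (R.arc 0) (R.arc 2) δ (triEmbed '' ω) (triEmbed '' ωᶜ)})
      from funext (jitteredLeg_real_zero R)]

/-! ### Geometry of `δ𝕋`: separation and closedness -/

/-- Mesh points are the dilated lattice points: `triMeshPoint δ '' T = δ • (triEmbed '' T)`. [folklore] -/
theorem image_triMeshPoint_eq_smul (δ : ℝ) (T : Set (Site 2)) :
    triMeshPoint δ '' T = (δ : ℂ) • (triEmbed '' T) := by
  rw [← image_smul, image_image]
  rfl

/-- `triMeshPoint 1` is the embedding `triEmbed`. [folklore] -/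
theorem triMeshPoint_one : triMeshPoint 1 = triEmbed := by
  funext v
  simp [triMeshPoint]

/-- **Distinct sites of `δ𝕋` are at distance `≥ δ`** (adjacent sites are at distance exactly `δ`,
non-adjacent distinct ones at distance `≥ √3 δ`). [folklore] -/
theorem le_dist_triMeshPoint_of_ne {δ : ℝ} (hδ : 0 < δ) {u w : Site 2} (h : u ≠ w) :
    δ ≤ dist (triMeshPoint δ u) (triMeshPoint δ w) := by
  by_contra hlt
  push Not at hlt
  have h3 : (1 : ℝ) < Real.sqrt 3 := by
    rw [Real.lt_sqrt (by norm_num)]; norm_num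
  have hlt' : dist (triMeshPoint δ u) (triMeshPoint δ w) < Real.sqrt 3 * δ :=
    hlt.trans (by nlinarith)
  rcases eq_or_adj_of_dist_triMeshPoint_lt hδ hlt' with huw | hadj
  · exact h huw
  · have hd : dist (triMeshPoint δ u) (triMeshPoint δ w) = δ := by
      rw [dist_eq_norm, triMeshPoint, triMeshPoint, ← mul_sub, norm_mul, Complex.norm_real,
        Real.norm_eq_abs, abs_of_pos hδ, norm_triEmbed_eq_one_of_adj hadj, mul_one]
    rw [hd] at hlt
    exact lt_irrefl δ hlt

/-- **Any set of sites of `δ𝕋` is closed** (`δ > 0`): a ball meets only finitely many mesh points. [folklore] -/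
theorem isClosed_image_triMeshPoint {δ : ℝ} (hδ : 0 < δ) (T : Set (Site 2)) :
    IsClosed (triMeshPoint δ '' T) := by
  refine isClosed_of_closure_subset fun z hz => ?_
  have hfin : (ball z 1 ∩ triMeshPoint δ '' T).Finite := by
    refine ((triMeshVertices_finite_holds (Ω := ball z 1) isBounded_ball hδ).image
      (triMeshPoint δ)).subset ?_
    rintro y ⟨hy, x, hx, rfl⟩
    exact ⟨x, (mem_triMeshVertices_iff).2 hy, rfl⟩
  have hz' : z ∈ closure (ball z 1 ∩ triMeshPoint δ '' T) :=
    isOpen_ball.inter_closure ⟨mem_ball_self one_pos, hz⟩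
  rw [hfin.isClosed.closure_eq] at hz'
  exact hz'.2

/-! ### The black region of the `𝕋`-colouring is the union of the black hexagons -/

/-- The closed Voronoi cell (hexagon) of a black site is black, provided there is a white site
(junk `infDist · ∅ = 0` otherwise). [cite: BollobasRiordan2006, Ch. 8 §8.1] -/
theorem voronoiCell_subset_blackRegion (δ : ℝ) {ω : Set (Site 2)} {v : Site 2} (hv : v ∈ ω)
    (hωc : ωᶜ.Nonempty) :
    voronoiCell (range (triMeshPoint δ)) (triMeshPoint δ v) ⊆
      blackRegion (triMeshPoint δ '' ω) (triMeshPoint δ '' ωᶜ) := by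
  intro z hz
  rw [mem_triVoronoiCell_iff] at hz
  rw [mem_blackRegion]
  refine (infDist_le_dist_of_mem (mem_image_of_mem _ hv)).trans ?_
  rw [le_infDist (hωc.image _)]
  rintro _ ⟨w, -, rfl⟩
  exact hz w

/-- **The black region of the `𝕋`-colouring `ω` is the union of the closed Voronoi cells of the
black sites** (both colours present): a black point has a nearest black site (the black sites
form a closed set), which is then a nearest site. [cite: BollobasRiordan2006, Ch. 8 §8.1] -/
theorem blackRegion_image_triMeshPoint {δ : ℝ} (hδ : 0 < δ) {ω : Set (Site 2)} (hω : ω.Nonempty)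
    (hωc : ωᶜ.Nonempty) :
    blackRegion (triMeshPoint δ '' ω) (triMeshPoint δ '' ωᶜ) =
      ⋃ v ∈ ω, voronoiCell (range (triMeshPoint δ)) (triMeshPoint δ v) := by
  refine Subset.antisymm (fun z hz => ?_) ?_
  · rw [mem_blackRegion] at hz
    obtain ⟨_, ⟨v, hv, rfl⟩, hdist⟩ :=
      (isClosed_image_triMeshPoint hδ ω).exists_infDist_eq_dist (hω.image _) z
    refine mem_iUnion₂.2 ⟨v, hv, mem_triVoronoiCell_iff.2 fun w => ?_⟩
    rw [← hdist]
    by_cases hw : w ∈ ω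
    · exact infDist_le_dist_of_mem (mem_image_of_mem _ hw)
    · exact hz.trans (infDist_le_dist_of_mem (mem_image_of_mem _ hw))
  · intro z hz
    obtain ⟨v, hv, hzv⟩ := mem_iUnion₂.1 hz
    exact voronoiCell_subset_blackRegion δ hv hωc hzv

/-- **The crossing event of the `𝕋`-colouring through black hexagons**: for `δ > 0` and a
colouring with both colours present, `voronoiCrossing Ω A A' δ (triEmbed '' ω) (triEmbed '' ωᶜ)`
says that a continuum path inside `closure Ω`, covered by the closed hexagons of `δ𝕋` of the black
sites, joins a point of `A` to a point of `A'`. [cite: BollobasRiordan2006, Ch. 8 §8.2] -/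
theorem voronoiCrossing_triEmbed_iff {δ : ℝ} (hδ : 0 < δ) {ω : Set (Site 2)} (hω : ω.Nonempty)
    (hωc : ωᶜ.Nonempty) (Ω A A' : Set ℂ) :
    voronoiCrossing Ω A A' δ (triEmbed '' ω) (triEmbed '' ωᶜ) ↔ ∃ x ∈ A, ∃ y ∈ A',
      JoinedIn (closure Ω ∩ ⋃ v ∈ ω, voronoiCell (range (triMeshPoint δ)) (triMeshPoint δ v))
        x y := by
  rw [voronoiCrossing_iff_smul hδ.ne', ← image_triMeshPoint_eq_smul, ← image_triMeshPoint_eq_smul,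
    blackRegion_image_triMeshPoint hδ hω hωc]

/-! ### The drawing of an open lattice path is black -/

/-- **The segment joining two adjacent sites of `δ𝕋` lies in the union of their two closed
cells**: a point of the segment within `δ/2` of one endpoint is at distance `≥ δ/2` from every
other site (distinct sites are `≥ δ` apart). [folklore] -/
theorem segment_subset_voronoiCell_union {δ : ℝ} (hδ : 0 < δ) {u v : Site 2}
    (huv : triGraph.Adj u v) :
    segment ℝ (triMeshPoint δ u) (triMeshPoint δ v) ⊆
      voronoiCell (range (triMeshPoint δ)) (triMeshPoint δ u) ∪
        voronoiCell (range (triMeshPoint δ)) (triMeshPoint δ v) := by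
  intro p hp
  have hsum : dist (triMeshPoint δ u) p + dist p (triMeshPoint δ v) = δ := by
    rw [(mem_segment_iff_wbtw.1 hp).dist_add_dist, dist_eq_norm, triMeshPoint, triMeshPoint,
      ← mul_sub, norm_mul, Complex.norm_real, Real.norm_eq_abs, abs_of_pos hδ,
      norm_triEmbed_eq_one_of_adj huv, mul_one]
  -- a point within `δ/2` of a site lies in its cell
  have key : ∀ {a : Site 2} {q : ℂ}, dist q (triMeshPoint δ a) ≤ δ / 2 →
      q ∈ voronoiCell (range (triMeshPoint δ)) (triMeshPoint δ a) := by
    intro a q hq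
    refine mem_triVoronoiCell_iff.2 fun w => ?_
    by_cases haw : a = w
    · rw [haw]
    · have h1 := le_dist_triMeshPoint_of_ne hδ haw
      have h2 := dist_triangle (triMeshPoint δ a) q (triMeshPoint δ w)
      rw [dist_comm (triMeshPoint δ a) q] at h2
      linarith
  by_cases hu : dist p (triMeshPoint δ u) ≤ δ / 2
  · exact Or.inl (key hu)
  · refine Or.inr (key ?_)
    rw [dist_comm] at hsum
    push Not at hu
    linarith

/-- **The segment joining two adjacent black sites is black** (so the polygonal drawing of an
open `𝕋`-path is a black continuum path). [cite: BollobasRiordan2006, Ch. 8 §8.1] -/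
theorem segment_subset_blackRegion {δ : ℝ} (hδ : 0 < δ) {ω : Set (Site 2)} (hωc : ωᶜ.Nonempty)
    {u v : Site 2} (hu : u ∈ ω) (hv : v ∈ ω) (huv : triGraph.Adj u v) :
    segment ℝ (triMeshPoint δ u) (triMeshPoint δ v) ⊆
      blackRegion (triMeshPoint δ '' ω) (triMeshPoint δ '' ωᶜ) := fun _ hp =>
  (segment_subset_voronoiCell_union hδ huv hp).elim
    (fun h => voronoiCell_subset_blackRegion δ hu hωc h)
    (fun h => voronoiCell_subset_blackRegion δ hv hωc h)

/-! ### The lattice shadow of a continuum crossing -/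

/-- **The lattice shadow of a continuum crossing** (Bollobás–Riordan 2006, Ch. 7 p. 199: "a
connected monochromatic set of hexagons contains a path of hexagons"): if the black hexagons of the
`𝕋`-colouring `ω` cross `closure Ω` from `A` to `A'` at scale `δ > 0` (`Ω` bounded, both colours
present), then there is a `𝕋`-path of black sites, all of whose hexagons meet `closure Ω`, from a
site whose hexagon meets `A ∩ closure Ω` to a site whose hexagon meets `A' ∩ closure Ω`.
[cite: BollobasRiordan2006, Ch. 7 proof of Thm. 2 p. 199] -/
theorem exists_pathIn_of_voronoiCrossing {δ : ℝ} (hδ : 0 < δ) {Ω A A' : Set ℂ}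
    (hΩ : Bornology.IsBounded Ω) {ω : Set (Site 2)} (hω : ω.Nonempty) (hωc : ωᶜ.Nonempty)
    (h : voronoiCrossing Ω A A' δ (triEmbed '' ω) (triEmbed '' ωᶜ)) :
    ∃ u w : Site 2,
      (A ∩ closure Ω ∩ voronoiCell (range (triMeshPoint δ)) (triMeshPoint δ u)).Nonempty ∧
      (A' ∩ closure Ω ∩ voronoiCell (range (triMeshPoint δ)) (triMeshPoint δ w)).Nonempty ∧
      PathIn triGraph {v | v ∈ ω ∧
        (closure Ω ∩ voronoiCell (range (triMeshPoint δ)) (triMeshPoint δ v)).Nonempty} u w := by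
  obtain ⟨x, hx, y, hy, hJ⟩ := (voronoiCrossing_triEmbed_iff hδ hω hωc Ω A A').1 h
  set γ := hJ.somePath with hγ
  have hγmem : ∀ t, γ t ∈ closure Ω ∩
      ⋃ v ∈ ω, voronoiCell (range (triMeshPoint δ)) (triMeshPoint δ v) := hJ.somePath_mem
  set S : Set ℂ := range γ with hS
  have hSconn : IsPreconnected S := (isConnected_range γ.continuous).isPreconnected
  have hSsub : S ⊆ closure Ω := by
    rintro _ ⟨t, rfl⟩; exact (hγmem t).1
  have hSb : Bornology.IsBounded S := hΩ.closure.subset hSsub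
  have hcov : S ⊆ ⋃ v ∈ ω, voronoiCell (range (triMeshPoint δ)) (triMeshPoint δ v) := by
    rintro _ ⟨t, rfl⟩; exact (hγmem t).2
  have hxS : x ∈ S := ⟨0, γ.source⟩
  have hyS : y ∈ S := ⟨1, γ.target⟩
  obtain ⟨u, w, hxu, hyw, hP⟩ := exists_pathIn_of_subset_triVoronoiCell hδ hSconn hSb hcov hxS hyS
  refine ⟨u, w, ⟨x, ⟨hx, hSsub hxS⟩, hxu⟩, ⟨y, ⟨hy, hSsub hyS⟩, hyw⟩, hP.mono ?_⟩
  rintro v ⟨hv, s, hsS, hsv⟩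
  exact ⟨hv, s, hSsub hsS, hsv⟩

end Summit.CriticalPhenomena.CardyFormulaZ2.Theorems

end
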